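import Mathlib
import Summits.Ventures.PercRepro2.Defs
import Summits.Ventures.PercRepro2.Independence
import Summits.Ventures.PercRepro2.Harris
import Summits.Ventures.PercRepro2.Graph
import Summits.Ventures.PercRepro2.Exploration
import Summits.Ventures.PercRepro2.Events
import Summits.Ventures.PercRepro2.FourFunctions
import Summits.Ventures.PercRepro2.Induced
import Summits.Ventures.PercRepro2.Frontier
import Summits.Ventures.PercRepro2.ObsIndependence
import Summits.Ventures.PercRepro2.BHK
import Summits.Ventures.PercRepro2.BHKEvents
import Summits.Ventures.PercRepro2.OrderPreservation
import Summits.Ventures.PercRepro2.OrderPreservationDual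
import Summits.Ventures.PercRepro2.VdBKahn
import Summits.Ventures.PercRepro2.BHKAvoid
import Summits.Ventures.PercRepro2.R2PrimeThreeReduction
import Summits.Ventures.PercRepro2.YBridge
import Summits.Ventures.PercRepro2.Yu1Functionals
import Summits.Ventures.PercRepro2.Yu1Events
import Summits.Ventures.PercRepro2.Yu1
import Summits.Ventures.PercRepro2.LBSplit
import Summits.Ventures.PercRepro2.YDelta
import Summits.Ventures.PercRepro2.Y
import Summits.Ventures.PercRepro2.RGapShare

/-!
# The L2 rung as a covariance comparison under the PD-tilt (blind cell PercRepro2, p1 g4;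
`proofs/P1-L2COV.md` §2, record rows (CC) / (CC-L2))

Light-first vocabulary (`a₁` light, `a₂` heavy, `a₃`, `o`, `b`; `R = avoidAll a₁ {a₂, a₃}`,
`PD ⊆ R`, `D = P(PD)`).  `RGapShare` gives the exact anatomy
`Z_0 + Z_h = P(PD, o ∈ C₂) gapR + slackL − covL − covH` with `slackL = P(PD, o ∈ C₁) gapR − P(PD) gapRoL ≥ 0`
and `covH ≤ P(PD, o ∈ C₂) gapR` (= (Yu2)), so `L2 ⟺ covL ≤ slackL + heavySlack` where
`heavySlack = P(PD, o ∈ C₂) · W − P(PD) · T_{h→l}` is the (Yu2)-slack.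

* `covR = P(R) P(R, o ∈ C₁, b ∈ C₁) − P(R, o ∈ C₁) P(R, b ∈ C₁)`: the same `(o, b)`-covariance of the
  light cluster in the R-world (`covL` is the PD-world one, `RGapShare.covL`).
* **`covR_le_slack`** (THEOREM): `P(PD) · covR ≤ P(R) · slackL` — the R-world covariance is dominated
  by the `o`-share slack of the R-order gap (two BHK 1.3 steps + the labelling).
* **`CovTilt`** (the record row (CC-L2), census 0 / 929 exact instances incl. 300 perturbations of the
  NEG-32 witnesses): `covL · P(R) ≤ P(PD) · covR + heavySlack · P(R)` — "the PD-tilt raises the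
  light `(o, b)`-covariance over its R-world value by at most the (Yu2)-slack".
* **`Z0Zh_of_CovTilt`**: `CovTilt → L2` (via `covR_le_slack` and `Z0Zh_of_covL_le`).
* `CovTiltGap` (row (CC)): the same with the payer `P(PD, o ∈ C₂) · gapR` (0 / 4,320; even with the
  payer divided by 100); it implies `LightCovBound` (= (R2PD)).
-/

namespace Summit.Ventures.PercRepro2

open UnionCluster Yu1

section CovTilt

variable {V : Type*} {E : Type*} [Fintype E] [DecidableEq E] [Fintype V] [DecidableEq V]
  {R : Type*} [Field R] [LinearOrder R] [IsStrictOrderedRing R]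

/-- `covR = P(R) · P(R, o ∈ C₁, b ∈ C₁) − P(R, o ∈ C₁) · P(R, b ∈ C₁)` (the R-world covariance of
`{o ∈ C₁}` and `{b ∈ C₁}`, cleared by `P(R)²`). -/
noncomputable def covR (p : E → R) (ends : E → Sym2 V) (o a₁ a₂ a₃ b : V) : R :=
  prob p (avoidAll ends a₁ {a₂, a₃}) *
      prob p (connEvent ends a₁ o ∩ connEvent ends a₁ b ∩ avoidAll ends a₁ {a₂, a₃}) -
    prob p (connEvent ends a₁ o ∩ avoidAll ends a₁ {a₂, a₃}) *
      prob p (connEvent ends a₁ b ∩ avoidAll ends a₁ {a₂, a₃})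

/-- The (Yu2)-slack `heavySlack = P(PD, o ∈ C₂) · W − P(PD) · T_{h→l}` (`≥ 0` by `yu2_cleared`). -/
noncomputable def heavySlack (p : E → R) (ends : E → Sym2 V) (o a₁ a₂ a₃ b : V) : R :=
  prob p (PDEvent ends a₁ a₂ a₃ ∩ connEvent ends a₂ o) *
      (massM2 p ends a₁ a₂ a₃ b + deltaT p ends a₁ a₂ a₃ b) -
    prob p (PDEvent ends a₁ a₂ a₃) *
      prob p (PDEvent ends a₁ a₂ a₃ ∩ connEvent ends a₂ o ∩ connEvent ends a₁ b)

/-- `0 ≤ heavySlack` is (Yu2). -/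
theorem heavySlack_nonneg (p : E → R) (hp : IsProbVec p) (ends : E → Sym2 V) {o a₁ a₂ a₃ b : V}
    (hord : prob p (connEvent ends a₁ b) ≤ prob p (connEvent ends a₂ b)) :
    0 ≤ heavySlack p ends o a₁ a₂ a₃ b := by
  unfold heavySlack
  linarith [yu2_cleared p hp ends (o := o) (a₃ := a₃) hord]

omit [Fintype V] [LinearOrder R] [IsStrictOrderedRing R] in
/-- `heavySlack = P(PD, o ∈ C₂) · gapR − covH`. -/
lemma heavySlack_eq (p : E → R) (ends : E → Sym2 V) (o a₁ a₂ a₃ b : V) :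
    heavySlack p ends o a₁ a₂ a₃ b =
      prob p (PDEvent ends a₁ a₂ a₃ ∩ connEvent ends a₂ o) * gapR p ends a₁ a₂ a₃ b -
        covH p ends o a₁ a₂ a₃ b := by
  unfold heavySlack covH
  rw [W_eq_gapR_add]
  ring

/-- **Cross step for `β`**: `P(o ∈ C₁, b ∈ C₂, R) · P(R) ≤ P(o ∈ C₁, R) · P(b ∈ C₂, R)`
(BHK 1.3 with `f = 1_o`, `g = 1 − β`). -/
lemma ob_beta_mul_le (p : E → R) (hp : IsProbVec p) (ends : E → Sym2 V) (o a₁ a₂ a₃ b : V) :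
    prob p (connEvent ends a₁ o ∩ connEvent ends a₂ b ∩ avoidAll ends a₁ {a₂, a₃}) *
        prob p (avoidAll ends a₁ {a₂, a₃}) ≤
      prob p (connEvent ends a₁ o ∩ avoidAll ends a₁ {a₂, a₃}) *
        prob p (connEvent ends a₂ b ∩ avoidAll ends a₁ {a₂, a₃}) := by
  have h := bhk_induced p hp ends a₁ (F₁ := (ind o : Set V → R))
    (F₂ := fun W => 1 - beta p ends a₂ b W)
    (ind_mono o)
    (fun W W' hW => sub_le_sub_left (beta_anti p hp ends a₂ b hW) 1)
    (ind_nonneg o)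
    (fun W => sub_nonneg.2 (beta_le_one p hp ends a₂ b W))
    Finset.univ {a₂, a₃} {a₂, a₃} (Finset.subset_univ _) (Finset.subset_univ _)
  simp only [REvent_univ, Finset.inter_self, Finset.union_self, expect_clusterObs_univ,
    Pi.mul_apply] at h
  have e1 : expect p (fun ω => (1 - beta p ends a₂ b (cluster ends ω a₁)) *
      (avoidAll ends a₁ {a₂, a₃}).indicator 1 ω) =
      prob p (avoidAll ends a₁ {a₂, a₃}) -
        expect p (fun ω => beta p ends a₂ b (cluster ends ω a₁) *
          (avoidAll ends a₁ {a₂, a₃}).indicator 1 ω) := by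
    rw [prob_eq_expect_indicator, ← expect_sub]
    congr 1
    funext ω
    simp only [Pi.sub_apply]
    ring
  have e2 : expect p (fun ω => ind o (cluster ends ω a₁) *
      (1 - beta p ends a₂ b (cluster ends ω a₁)) * (avoidAll ends a₁ {a₂, a₃}).indicator 1 ω) =
      expect p (fun ω => ind o (cluster ends ω a₁) * (avoidAll ends a₁ {a₂, a₃}).indicator 1 ω) -
        expect p (fun ω => ind o (cluster ends ω a₁) * beta p ends a₂ b (cluster ends ω a₁) *
          (avoidAll ends a₁ {a₂, a₃}).indicator 1 ω) := by
    rw [← expect_sub]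
    congr 1
    funext ω
    simp only [Pi.sub_apply]
    ring
  rw [e1, e2] at h
  rw [tower_ob_beta, tower_N, tower_b p ends a₁ a₂ a₃ o]
  nlinarith [h]

omit [Fintype V] [LinearOrder R] [IsStrictOrderedRing R] in
/-- Exact: `P(R) · slackL = gapR · [P(PD, o ∈ C₁) P(R) − P(PD) P(R, o ∈ C₁)] + P(PD) · (covR − covRβ)`
with `covRβ = P(R) P(o ∈ C₁, b ∈ C₂, R) − P(o ∈ C₁, R) P(b ∈ C₂, R)`. -/
lemma slack_mul_eq (p : E → R) (ends : E → Sym2 V) (o a₁ a₂ a₃ b : V) :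
    prob p (avoidAll ends a₁ {a₂, a₃}) *
        (prob p (PDEvent ends a₁ a₂ a₃ ∩ connEvent ends a₁ o) * gapR p ends a₁ a₂ a₃ b -
          prob p (PDEvent ends a₁ a₂ a₃) * gapRoL p ends o a₁ a₂ a₃ b) =
      gapR p ends a₁ a₂ a₃ b *
          (prob p (PDEvent ends a₁ a₂ a₃ ∩ connEvent ends a₁ o) * prob p (avoidAll ends a₁ {a₂, a₃}) -
            prob p (PDEvent ends a₁ a₂ a₃) *
              prob p (connEvent ends a₁ o ∩ avoidAll ends a₁ {a₂, a₃})) +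
        prob p (PDEvent ends a₁ a₂ a₃) *
          (covR p ends o a₁ a₂ a₃ b -
            (prob p (avoidAll ends a₁ {a₂, a₃}) *
                prob p (connEvent ends a₁ o ∩ connEvent ends a₂ b ∩ avoidAll ends a₁ {a₂, a₃}) -
              prob p (connEvent ends a₁ o ∩ avoidAll ends a₁ {a₂, a₃}) *
                prob p (connEvent ends a₂ b ∩ avoidAll ends a₁ {a₂, a₃}))) := by
  unfold covR gapR gapRoL
  ring

/-- **`P(PD) · covR ≤ P(R) · slackL`** (THEOREM, under the labelling): the R-world covariance of
`{o ∈ C₁}`, `{b ∈ C₁}` is dominated by the `o`-share slack of the R-order gap — the same-cluster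
step `oR_mul_PD_le`, the cross step `ob_beta_mul_le` and `0 ≤ gapR`. -/
theorem covR_le_slack (p : E → R) (hp : IsProbVec p) (ends : E → Sym2 V) {o a₁ a₂ a₃ b : V}
    (hord : prob p (connEvent ends a₁ b) ≤ prob p (connEvent ends a₂ b)) :
    prob p (PDEvent ends a₁ a₂ a₃) * covR p ends o a₁ a₂ a₃ b ≤
      prob p (avoidAll ends a₁ {a₂, a₃}) *
        (prob p (PDEvent ends a₁ a₂ a₃ ∩ connEvent ends a₁ o) * gapR p ends a₁ a₂ a₃ b -
          prob p (PDEvent ends a₁ a₂ a₃) * gapRoL p ends o a₁ a₂ a₃ b) := by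
  rw [slack_mul_eq]
  have h1 := oR_mul_PD_le p hp ends o a₁ a₂ a₃
  have h2 := ob_beta_mul_le p hp ends o a₁ a₂ a₃ b
  have hg := gapR_nonneg p hp ends (a₃ := a₃) hord
  have hD : 0 ≤ prob p (PDEvent ends a₁ a₂ a₃) := prob_nonneg hp _
  nlinarith [mul_nonneg hg (sub_nonneg.2 h1), mul_nonneg hD (sub_nonneg.2 h2)]

/-- **(CC-L2)**: `covL · P(R) ≤ P(PD) · covR + heavySlack · P(R)` — the PD-tilt raises the light
`(o, b)`-covariance over its R-world value by at most the (Yu2)-slack.  Census (exact): 0 / 929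
instances incl. 300 perturbations of the NEG-32 witnesses; implies the L2 rung (`Z0Zh_of_CovTilt`).
OPEN. -/
def CovTilt (p : E → R) (ends : E → Sym2 V) (o a₁ a₂ a₃ b : V) : Prop :=
  covL p ends o a₁ a₂ a₃ b * prob p (avoidAll ends a₁ {a₂, a₃}) ≤
    prob p (PDEvent ends a₁ a₂ a₃) * covR p ends o a₁ a₂ a₃ b +
      heavySlack p ends o a₁ a₂ a₃ b * prob p (avoidAll ends a₁ {a₂, a₃})

/-- **(CC)**: the same with the payer `P(PD, o ∈ C₂) · gapR` (0 / 4,320 exact instances; the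
no-payer version fails only when `P(PD, o ∈ C₂) > 0`, by at most `1e−10`).  It implies
`LightCovBound` (= (R2PD)) by `covR_le_slack`. -/
def CovTiltGap (p : E → R) (ends : E → Sym2 V) (o a₁ a₂ a₃ b : V) : Prop :=
  covL p ends o a₁ a₂ a₃ b * prob p (avoidAll ends a₁ {a₂, a₃}) ≤
    prob p (PDEvent ends a₁ a₂ a₃) * covR p ends o a₁ a₂ a₃ b +
      prob p (PDEvent ends a₁ a₂ a₃ ∩ connEvent ends a₂ o) * gapR p ends a₁ a₂ a₃ b *
        prob p (avoidAll ends a₁ {a₂, a₃})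

/-- Dividing by `P(R) > 0` (the `P(R) = 0` case is degenerate: `covL`, `slackL` vanish and the
payer `X` is non-negative). -/
lemma covL_le_of_mul (p : E → R) (hp : IsProbVec p) (ends : E → Sym2 V) {o a₁ a₂ a₃ b : V}
    {X : R} (hX : 0 ≤ X)
    (h : covL p ends o a₁ a₂ a₃ b * prob p (avoidAll ends a₁ {a₂, a₃}) ≤
      prob p (PDEvent ends a₁ a₂ a₃) * covR p ends o a₁ a₂ a₃ b +
        X * prob p (avoidAll ends a₁ {a₂, a₃}))
    (hord : prob p (connEvent ends a₁ b) ≤ prob p (connEvent ends a₂ b)) :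
    covL p ends o a₁ a₂ a₃ b ≤
      (prob p (PDEvent ends a₁ a₂ a₃ ∩ connEvent ends a₁ o) * gapR p ends a₁ a₂ a₃ b -
        prob p (PDEvent ends a₁ a₂ a₃) * gapRoL p ends o a₁ a₂ a₃ b) + X := by
  have hs := covR_le_slack p hp ends (o := o) (a₃ := a₃) hord
  rcases (prob_nonneg hp (avoidAll ends a₁ {a₂, a₃})).lt_or_eq with hpos | hzero
  · refine le_of_mul_le_mul_right ?_ hpos
    nlinarith [h, hs]
  · -- `P(R) = 0`: `P(PD) = 0`, `P(PD, o ∈ C₁) = 0`, hence `covL = 0` and `slackL = 0`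
    have hsub : PDEvent ends a₁ a₂ a₃ ⊆ avoidAll ends a₁ {a₂, a₃} := by
      intro ω hω
      rw [← PD_event_eq] at hω
      exact hω.2
    have hPD : prob p (PDEvent ends a₁ a₂ a₃) = 0 :=
      le_antisymm (hzero ▸ prob_mono hp hsub) (prob_nonneg hp _)
    have hPDo : prob p (PDEvent ends a₁ a₂ a₃ ∩ connEvent ends a₁ o) = 0 :=
      le_antisymm (hzero ▸ prob_mono hp (Set.inter_subset_left.trans hsub)) (prob_nonneg hp _)
    have hcov : covL p ends o a₁ a₂ a₃ b = 0 := by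
      unfold covL
      rw [hPD, hPDo]
      ring
    rw [hcov, hPD, hPDo]
    linarith

/-- **The L2 rung from (CC-L2)**: `CovTilt → Z_0 + Z_h ≥ 0` (in the `Z0ZhNonneg_iff` form). -/
theorem Z0Zh_of_CovTilt (p : E → R) (hp : IsProbVec p) (ends : E → Sym2 V) {o a₁ a₂ a₃ b : V}
    (hord : prob p (connEvent ends a₁ b) ≤ prob p (connEvent ends a₂ b))
    (hCC : CovTilt p ends o a₁ a₂ a₃ b) :
    prob p (PDEvent ends a₁ a₂ a₃) *
        (prob p (PDEvent ends a₁ a₂ a₃ ∩ connEvent ends a₁ o ∩ connEvent ends a₂ b) +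
          prob p (PDEvent ends a₁ a₂ a₃ ∩ connEvent ends a₂ o ∩ connEvent ends a₁ b) +
          (prob p (TEvent ends a₁ a₂ a₃ ∩ connEvent ends a₁ o ∩ connEvent ends a₂ b) -
            prob p (TEvent ends a₁ a₂ a₃ ∩ connEvent ends a₁ o ∩ connEvent ends a₁ b))) ≤
      (prob p (PDEvent ends a₁ a₂ a₃ ∩ connEvent ends a₁ o) +
          prob p (PDEvent ends a₁ a₂ a₃ ∩ connEvent ends a₂ o)) *
        (massM2 p ends a₁ a₂ a₃ b + deltaT p ends a₁ a₂ a₃ b) := by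
  apply Z0Zh_of_covL_le p ends
  have h := covL_le_of_mul p hp ends (o := o) (heavySlack_nonneg p hp ends (o := o) (a₃ := a₃) hord) hCC hord
  rw [heavySlack_eq] at h
  linarith

/-- **(R2PD) from (CC)**: `CovTiltGap → LightCovBound`. -/
theorem LightCovBound_of_CovTiltGap (p : E → R) (hp : IsProbVec p) (ends : E → Sym2 V)
    {o a₁ a₂ a₃ b : V} (hord : prob p (connEvent ends a₁ b) ≤ prob p (connEvent ends a₂ b))
    (hCC : CovTiltGap p ends o a₁ a₂ a₃ b) : LightCovBound p ends o a₁ a₂ a₃ b := by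
  unfold LightCovBound
  exact covL_le_of_mul p hp ends (o := o)
    (mul_nonneg (prob_nonneg hp _) (gapR_nonneg p hp ends (a₃ := a₃) hord)) hCC hord

end CovTilt

end Summit.Ventures.PercRepro2
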